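import Summits.QuantumFields.YangMills.Theorems.AllWindowsColdBoxBoxKernelReflection
import Literature.MathematicalPhysics.QuantumFieldTheory.TiltedTorusSwapRP

/-!
# The Dirichlet/Neumann box Laplacian and its Green function by images
# (estimate (T) of STUB-PLAN-K1-24006 for LINE-18 stub K1, crux `AllWindowsColdBox.BulkMidWindowSU2`, stmt-QuantumFields-24006 — part 2)

* `Box d M Dset` — the sites: coordinates in `{0,…,M−1}`, nonzero in the Dirichlet directions `Dset` (`M − 1` Dirichlet sites `1..M−1`
  between the zeros `0, M`; `M` Neumann sites `0..M−1`); `coords` — integer coordinates;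
* `boxLap M Dset` — the Kronecker sum of the path-graph Laplacians: diagonal `2` per direction and `−1` per present neighbour, where a
  missing neighbour beyond a DIRICHLET face keeps its diagonal `1` (zero ghost, `upCoeff`/`downCoeff = 1`) and beyond a NEUMANN face
  drops it (reflected ghost, coefficient `0`) — for `d = 4`, `M = 2H+2`, `Dset = {ν ≠ μ}` this is the operator `L_μ` of STUB-PLAN-K1
  §1(ii) on the `μ`-edges of `E_rel` (K1-B identifies the two index sets);
* `boxGreenMat` — the image-sum kernel `G_B(s,t) = ½ Σ_σ sgn(σ) G̃_{2M}(ι s − σ·ι t)` read on the box;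
* ghost lemmas `boxGreen_dirichlet_top/bottom` (the kernel vanishes on the Dirichlet ghosts), `boxGreen_neumann_top/bottom` (it is
  reflected on the Neumann ghosts); `toTorus_coords_eq_refl_iff` (images of box points leave the box);
* **`boxLap_mul_boxGreenMat`: `boxLap · G_B = 1`**, hence `boxLap_inv_eq : boxLap⁻¹ = G_B` and `isUnit_det_boxLap` (for a nonempty `Dset`).
So the Green function of every such box is an explicit signed sum of `2^d` torus Green functions — the input of the decay estimate in
part 3.  Standard axioms.

HONEST LABEL: helper toward one registered stub (K1, OPEN) of a critic-passed line on the R2ξ″ RECORD-rung crux 24006; no stub, crux, rung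
or summit is proved here; the Yang–Mills mass gap is NOT proved by this file.
-/

set_option autoImplicit false

noncomputable section

open Finset ZMod
open scoped Real BigOperators

namespace Summit.QuantumFields.YangMills.Theorems.AllWindowsColdBox.BoxKernel

open Literature.Probability.LatticeModels

variable {d : ℕ}

/-! ## The box and its operator -/

/-- Points of the box: coordinates in `{0,…,M−1}`, nonzero in the Dirichlet directions `Dset`
(so a Dirichlet direction has the `M − 1` sites `1,…,M−1` between the zeros `0` and `M`, a Neumann direction the `M` sites `0,…,M−1`). -/
abbrev Box (d M : ℕ) (Dset : Finset (Fin d)) : Type := {s : Fin d → Fin M // ∀ ν ∈ Dset, (s ν : ℕ) ≠ 0}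

variable {M : ℕ} {Dset : Finset (Fin d)}

/-- Integer coordinates of a box point. -/
def coords (s : Box d M Dset) : Fin d → ℤ := fun ν => ((s.1 ν : ℕ) : ℤ)

/-- Integer coordinates determine the box point. -/
theorem coords_injective : Function.Injective (coords : Box d M Dset → Fin d → ℤ) := by
  intro s t h
  apply Subtype.ext
  funext ν
  have := congrFun h ν
  simp only [coords, Nat.cast_inj] at this
  exact Fin.ext this

variable (M Dset) in
/-- Diagonal coefficient of the upper neighbour in direction `ν`: `1` unless the neighbour is a missing NEUMANN ghost. -/
def upCoeff (ν : Fin d) (s : Box d M Dset) : ℝ := if ν ∈ Dset ∨ (s.1 ν : ℕ) + 1 < M then 1 else 0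

variable (Dset) in
/-- Diagonal coefficient of the lower neighbour in direction `ν`: `1` unless the neighbour is a missing NEUMANN ghost. -/
def downCoeff (ν : Fin d) (s : Box d M Dset) : ℝ := if ν ∈ Dset ∨ 1 ≤ (s.1 ν : ℕ) then 1 else 0

variable (M Dset) in
/-- **The box Laplacian with Dirichlet faces in the directions `Dset` and Neumann faces in the others**: the Kronecker sum of the
path-graph Laplacians (`2` on the diagonal per direction, `−1` per present neighbour), where a missing neighbour beyond a Dirichlet face
keeps its diagonal `1` (zero ghost) and a missing neighbour beyond a Neumann face drops it (reflected ghost). -/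
def boxLap : Matrix (Box d M Dset) (Box d M Dset) ℝ := Matrix.of fun s t =>
  ∑ ν : Fin d, ((if t = s then upCoeff M Dset ν s + downCoeff Dset ν s else 0) -
    (if coords t = coords s + Pi.single ν 1 then 1 else 0) - (if coords t = coords s - Pi.single ν 1 then 1 else 0))

variable (M Dset) in
/-- The image-sum kernel read on the box. -/
def boxGreenMat [NeZero M] : Matrix (Box d M Dset) (Box d M Dset) ℝ := Matrix.of fun s t => boxGreen M Dset (coords s) (coords t)

/-! ## Neighbours -/

/-- A sum over the box of a function supported at one lattice point. -/
theorem sum_ite_coords_eq (y : Fin d → ℤ) (g : (Fin d → ℤ) → ℝ) :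
    ∑ t : Box d M Dset, (if coords t = y then g (coords t) else 0) = if (∃ t : Box d M Dset, coords t = y) then g y else 0 := by
  split_ifs with h
  · obtain ⟨t₀, ht₀⟩ := h
    rw [Finset.sum_eq_single t₀]
    · rw [if_pos ht₀, ht₀]
    · intro t _ ht
      rw [if_neg]
      intro h'
      exact ht (coords_injective (h'.trans ht₀.symm))
    · intro h; exact absurd (Finset.mem_univ _) h
  · push Not at h
    exact Finset.sum_eq_zero fun t _ => if_neg (h t)

/-- The upper neighbour in direction `ν` is a box point iff `s_ν + 1 < M`. -/
theorem exists_coords_eq_add_iff (s : Box d M Dset) (ν : Fin d) :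
    (∃ t : Box d M Dset, coords t = coords s + Pi.single ν 1) ↔ (s.1 ν : ℕ) + 1 < M := by
  constructor
  · rintro ⟨t, ht⟩
    have h1 := congrFun ht ν
    simp only [coords, Pi.add_apply, Pi.single_eq_same] at h1
    have h2 : (t.1 ν : ℕ) < M := (t.1 ν).isLt
    omega
  · intro h
    refine ⟨⟨Function.update s.1 ν ⟨(s.1 ν : ℕ) + 1, h⟩, fun κ hκ => ?_⟩, ?_⟩
    · by_cases hκν : κ = ν
      · subst hκν; simp
      · rw [Function.update_of_ne hκν]; exact s.2 κ hκ
    · funext κ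
      by_cases hκν : κ = ν
      · subst hκν; simp [coords]
      · simp [coords, Function.update_of_ne hκν, Pi.single_eq_of_ne hκν]

/-- The lower neighbour in direction `ν` is a box point iff `s_ν ≥ 1`, and `s_ν ≥ 2` in a Dirichlet direction. -/
theorem exists_coords_eq_sub_iff (s : Box d M Dset) (ν : Fin d) :
    (∃ t : Box d M Dset, coords t = coords s - Pi.single ν 1) ↔ (1 ≤ (s.1 ν : ℕ) ∧ (ν ∈ Dset → 2 ≤ (s.1 ν : ℕ))) := by
  constructor
  · rintro ⟨t, ht⟩
    have h1 := congrFun ht ν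
    simp only [coords, Pi.sub_apply, Pi.single_eq_same] at h1
    refine ⟨by omega, fun hD => ?_⟩
    have := t.2 ν hD
    omega
  · rintro ⟨h1, h2⟩
    have hlt : (s.1 ν : ℕ) - 1 < M := lt_of_le_of_lt (Nat.sub_le _ _) (s.1 ν).isLt
    refine ⟨⟨Function.update s.1 ν ⟨(s.1 ν : ℕ) - 1, hlt⟩, fun κ hκ => ?_⟩, ?_⟩
    · by_cases hκν : κ = ν
      · subst hκν; have := h2 hκ; simp; omega
      · rw [Function.update_of_ne hκν]; exact s.2 κ hκ
    · funext κ
      by_cases hκν : κ = ν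
      · subst hκν; simp [coords]; omega
      · simp [coords, Function.update_of_ne hκν, Pi.single_eq_of_ne hκν]

/-! ## The kernel on the ghost points -/

/-- `ι (y + e_ν) = ι y + e_ν`. -/
theorem toTorus_add_single (M : ℕ) (y : Fin d → ℤ) (ν : Fin d) :
    toTorus M (y + Pi.single ν 1) = toTorus M y + Pi.single ν 1 := by
  funext κ
  by_cases hκ : κ = ν
  · subst hκ; simp [toTorus]
  · simp [toTorus, Pi.single_eq_of_ne hκ]

/-- `ι (y − e_ν) = ι y − e_ν`. -/
theorem toTorus_sub_single (M : ℕ) (y : Fin d → ℤ) (ν : Fin d) :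
    toTorus M (y - Pi.single ν 1) = toTorus M y - Pi.single ν 1 := by
  funext κ
  by_cases hκ : κ = ν
  · subst hκ; simp [toTorus]
  · simp [toTorus, Pi.single_eq_of_ne hκ]

variable [NeZero M]

/-- Dirichlet top ghost: the kernel vanishes at `s + e_ν` when `s_ν = M − 1`, `ν ∈ Dset`. -/
theorem boxGreen_dirichlet_top {ν : Fin d} (hν : ν ∈ Dset) (s : Box d M Dset) (h : (s.1 ν : ℕ) + 1 = M) (y' : Fin d → ℤ) :
    boxGreen M Dset (coords s + Pi.single ν 1) y' = 0 := by
  unfold boxGreen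
  apply imageSum_eq_zero_of_fixed hν
  have hM : ((s.1 ν : ℕ) : ℤ) + 1 = ((M : ℕ) : ℤ) := by exact_mod_cast h
  have hc : toTorus M (coords s + Pi.single ν 1) ν = ((M : ℕ) : ZMod (2 * M)) := by
    simp only [toTorus, coords, Pi.add_apply, Pi.single_eq_same]
    rw [hM, Int.cast_natCast]
  rw [hc, Literature.MathematicalPhysics.QuantumFieldTheory.TiltedTorusRP.neg_natCast_N]

/-- Dirichlet bottom ghost: the kernel vanishes at `s − e_ν` when `s_ν = 1`, `ν ∈ Dset`. -/
theorem boxGreen_dirichlet_bottom {ν : Fin d} (hν : ν ∈ Dset) (s : Box d M Dset) (h : (s.1 ν : ℕ) = 1) (y' : Fin d → ℤ) :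
    boxGreen M Dset (coords s - Pi.single ν 1) y' = 0 := by
  unfold boxGreen
  apply imageSum_eq_zero_of_fixed hν
  have hc : toTorus M (coords s - Pi.single ν 1) ν = 0 := by
    simp only [toTorus, coords, Pi.sub_apply, Pi.single_eq_same, h]
    push_cast; ring
  rw [hc, neg_zero]

/-- Neumann top ghost: the kernel at `s + e_ν` equals the kernel at `s` when `s_ν = M − 1`, `ν ∉ Dset`. -/
theorem boxGreen_neumann_top {ν : Fin d} (hν : ν ∉ Dset) (s : Box d M Dset) (h : (s.1 ν : ℕ) + 1 = M) (y' : Fin d → ℤ) :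
    boxGreen M Dset (coords s + Pi.single ν 1) y' = boxGreen M Dset (coords s) y' := by
  unfold boxGreen
  have hw : toTorus M (coords s + Pi.single ν 1) =
      Function.update (toTorus M (coords s)) ν (-1 - (toTorus M (coords s)) ν) := by
    funext κ
    by_cases hκ : κ = ν
    · subst hκ
      have h' : (s.1 κ : ℕ) = M - 1 := by omega
      have hc : ((s.1 κ : ℕ) : ZMod (2 * M)) = (M : ZMod (2 * M)) - 1 := by
        rw [h', Nat.cast_sub (by omega : 1 ≤ M), Nat.cast_one]
      simp only [toTorus, coords, Pi.add_apply, Pi.single_eq_same, Function.update_self]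
      push_cast
      rw [hc]
      have := Literature.MathematicalPhysics.QuantumFieldTheory.TiltedTorusRP.neg_natCast_N (N := M)
      linear_combination -this
    · simp [toTorus, Function.update_of_ne hκ, Pi.single_eq_of_ne hκ]
  rw [hw, imageSum_reflect_not_mem hν]

/-- Neumann bottom ghost: the kernel at `s − e_ν` equals the kernel at `s` when `s_ν = 0`, `ν ∉ Dset`. -/
theorem boxGreen_neumann_bottom {ν : Fin d} (hν : ν ∉ Dset) (s : Box d M Dset) (h : (s.1 ν : ℕ) = 0) (y' : Fin d → ℤ) :
    boxGreen M Dset (coords s - Pi.single ν 1) y' = boxGreen M Dset (coords s) y' := by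
  unfold boxGreen
  have hw : toTorus M (coords s - Pi.single ν 1) =
      Function.update (toTorus M (coords s)) ν (-1 - (toTorus M (coords s)) ν) := by
    funext κ
    by_cases hκ : κ = ν
    · subst hκ
      simp only [toTorus, coords, Pi.sub_apply, Pi.single_eq_same, Function.update_self, h]
      push_cast; ring
    · simp [toTorus, Function.update_of_ne hκ, Pi.single_eq_of_ne hκ]
  rw [hw, imageSum_reflect_not_mem hν]

/-! ## Images of box points -/

omit [NeZero M] in
/-- **The images of box points are disjoint from the box**: `ι s = σ·ι s'` forces `σ` trivial and `s = s'`. -/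
theorem toTorus_coords_eq_refl_iff (s s' : Box d M Dset) (σ : Fin d → Bool) :
    toTorus M (coords s) = refl M Dset σ (toTorus M (coords s')) ↔ (σ = fun _ => false) ∧ s = s' := by
  constructor
  · intro h
    have hσ : ∀ ν, σ ν = false := by
      intro ν
      by_contra hν'
      have hν : σ ν = true := by cases h' : σ ν <;> simp_all
      have hc := congrFun h ν
      simp only [toTorus, coords, refl, hν, if_true, Int.cast_natCast] at hc
      have hs : (s.1 ν : ℕ) < M := (s.1 ν).isLt
      have hs' : (s'.1 ν : ℕ) < M := (s'.1 ν).isLt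
      by_cases hD : ν ∈ Dset
      · rw [if_pos hD] at hc
        have h0 : ((((s.1 ν : ℕ) + (s'.1 ν : ℕ) : ℕ)) : ZMod (2 * M)) = 0 := by
          push_cast; rw [hc]; ring
        rw [ZMod.natCast_eq_zero_iff] at h0
        have h1 : 0 < (s.1 ν : ℕ) + s'.1 ν := by have := s.2 ν hD; omega
        have := Nat.le_of_dvd h1 h0
        omega
      · rw [if_neg hD] at hc
        have h0 : ((((s.1 ν : ℕ) + (s'.1 ν : ℕ) + 1 : ℕ)) : ZMod (2 * M)) = 0 := by
          push_cast; rw [hc]; ring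
        rw [ZMod.natCast_eq_zero_iff] at h0
        have := Nat.le_of_dvd (by omega) h0
        omega
    have hσ' : σ = fun _ => false := funext hσ
    refine ⟨hσ', ?_⟩
    subst hσ'
    apply coords_injective
    funext ν
    have hc := congrFun h ν
    simp only [toTorus, coords, refl, Int.cast_natCast] at hc
    have hs : (s.1 ν : ℕ) < 2 * M := by have := (s.1 ν).isLt; omega
    have hs' : (s'.1 ν : ℕ) < 2 * M := by have := (s'.1 ν).isLt; omega
    have := (ZMod.natCast_eq_natCast_iff' _ _ _).1 hc
    rw [Nat.mod_eq_of_lt hs, Nat.mod_eq_of_lt hs'] at this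
    simp only [coords, this]
  · rintro ⟨rfl, rfl⟩
    funext ν
    simp [refl]

/-! ## The Green identity -/

/-- **`boxLap · G_B = 1`**: the image-sum kernel is a right inverse of the D/N box Laplacian (for at least one Dirichlet direction). -/
theorem boxLap_mul_boxGreenMat (hD : Dset.Nonempty) : boxLap M Dset * boxGreenMat M Dset = 1 := by
  ext s s'
  set F : (Fin d → ℤ) → ℝ := fun y => boxGreen M Dset y (coords s') with hF
  -- the three pieces of the `t`-sum, per direction
  have hA : ∀ ν : Fin d, ∑ t : Box d M Dset, (if t = s then upCoeff M Dset ν s + downCoeff Dset ν s else 0) * F (coords t) =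
      (upCoeff M Dset ν s + downCoeff Dset ν s) * F (coords s) := by
    intro ν
    rw [Finset.sum_eq_single s (fun t _ ht => by rw [if_neg ht, zero_mul]) (fun h => absurd (Finset.mem_univ _) h), if_pos rfl]
  have hB : ∀ (y : Fin d → ℤ), ∑ t : Box d M Dset, (if coords t = y then (1 : ℝ) else 0) * F (coords t) =
      if (∃ t : Box d M Dset, coords t = y) then F y else 0 := by
    intro y
    rw [← sum_ite_coords_eq y F]
    exact Finset.sum_congr rfl fun t _ => by split_ifs <;> simp
  have hup : ∀ ν : Fin d, upCoeff M Dset ν s * F (coords s) -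
      (if (∃ t : Box d M Dset, coords t = coords s + Pi.single ν 1) then F (coords s + Pi.single ν 1) else 0) =
      F (coords s) - F (coords s + Pi.single ν 1) := by
    intro ν
    simp only [exists_coords_eq_add_iff s ν]
    unfold upCoeff
    by_cases h : (s.1 ν : ℕ) + 1 < M
    · rw [if_pos (Or.inr h), if_pos h, one_mul]
    · have hM : (s.1 ν : ℕ) + 1 = M := by have := (s.1 ν).isLt; omega
      rw [if_neg h]
      by_cases hν : ν ∈ Dset
      · rw [if_pos (Or.inl hν), one_mul, hF]
        simp only [boxGreen_dirichlet_top hν s hM]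
      · rw [if_neg (by push Not; exact ⟨hν, not_lt.1 h⟩), zero_mul, hF]
        simp only [boxGreen_neumann_top hν s hM]
        ring
  have hdown : ∀ ν : Fin d, downCoeff Dset ν s * F (coords s) -
      (if (∃ t : Box d M Dset, coords t = coords s - Pi.single ν 1) then F (coords s - Pi.single ν 1) else 0) =
      F (coords s) - F (coords s - Pi.single ν 1) := by
    intro ν
    simp only [exists_coords_eq_sub_iff s ν]
    unfold downCoeff
    by_cases hν : ν ∈ Dset
    · rw [if_pos (Or.inl hν), one_mul]
      have h1 : 1 ≤ (s.1 ν : ℕ) := Nat.one_le_iff_ne_zero.2 (s.2 ν hν)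
      by_cases h2 : 2 ≤ (s.1 ν : ℕ)
      · rw [if_pos ⟨h1, fun _ => h2⟩]
      · rw [if_neg (by push Not; exact fun _ => ⟨hν, by omega⟩), hF]
        simp only [boxGreen_dirichlet_bottom hν s (by omega)]
    · by_cases h1 : 1 ≤ (s.1 ν : ℕ)
      · rw [if_pos (Or.inr h1), one_mul, if_pos ⟨h1, fun h => absurd h hν⟩]
      · rw [if_neg (by push Not; exact ⟨hν, by omega⟩), zero_mul, if_neg (by push Not; exact fun h => absurd h (by omega)), hF]
        simp only [boxGreen_neumann_bottom hν s (by omega)]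
        ring
  -- assemble
  rw [Matrix.mul_apply, Matrix.one_apply]
  have hentry : ∀ t : Box d M Dset, boxLap M Dset s t * boxGreenMat M Dset t s' =
      ∑ ν : Fin d, (((if t = s then upCoeff M Dset ν s + downCoeff Dset ν s else 0) * F (coords t)) -
        ((if coords t = coords s + Pi.single ν 1 then (1 : ℝ) else 0) * F (coords t)) -
        ((if coords t = coords s - Pi.single ν 1 then (1 : ℝ) else 0) * F (coords t))) := by
    intro t
    simp only [boxLap, boxGreenMat, Matrix.of_apply, hF, Finset.sum_mul, sub_mul]
  rw [Finset.sum_congr rfl fun t _ => hentry t, Finset.sum_comm]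
  have hν : ∀ ν : Fin d, ∑ t : Box d M Dset, (((if t = s then upCoeff M Dset ν s + downCoeff Dset ν s else 0) * F (coords t)) -
        ((if coords t = coords s + Pi.single ν 1 then (1 : ℝ) else 0) * F (coords t)) -
        ((if coords t = coords s - Pi.single ν 1 then (1 : ℝ) else 0) * F (coords t))) =
      2 * imageSum M Dset (toTorus M (coords s')) (toTorus M (coords s)) -
        imageSum M Dset (toTorus M (coords s')) (toTorus M (coords s) + Pi.single ν 1) -
        imageSum M Dset (toTorus M (coords s')) (toTorus M (coords s) - Pi.single ν 1) := by
    intro ν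
    rw [Finset.sum_sub_distrib, Finset.sum_sub_distrib, hA, hB, hB]
    have h1 := hup ν
    have h2 := hdown ν
    have e : F (coords s + Pi.single ν 1) = imageSum M Dset (toTorus M (coords s')) (toTorus M (coords s) + Pi.single ν 1) := by
      rw [hF]; simp only [boxGreen, toTorus_add_single]
    have e' : F (coords s - Pi.single ν 1) = imageSum M Dset (toTorus M (coords s')) (toTorus M (coords s) - Pi.single ν 1) := by
      rw [hF]; simp only [boxGreen, toTorus_sub_single]
    have e0 : F (coords s) = imageSum M Dset (toTorus M (coords s')) (toTorus M (coords s)) := by rw [hF]; simp only [boxGreen]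
    rw [← e, ← e', ← e0]
    linarith
  rw [Finset.sum_congr rfl fun ν _ => hν ν, imageSum_laplacian hD]
  have hσ : ∀ σ : Fin d → Bool, (sgn Dset σ * if toTorus M (coords s) = refl M Dset σ (toTorus M (coords s')) then (1 : ℝ) else 0) =
      if σ = (fun _ => false) then (if s = s' then 1 else 0) else 0 := by
    intro σ
    simp only [toTorus_coords_eq_refl_iff s s' σ]
    by_cases h1 : σ = fun _ => false
    · subst h1
      by_cases h2 : s = s' <;> simp [h2, sgn_false]
    · simp [h1]
  rw [Finset.sum_congr rfl fun σ _ => hσ σ, Finset.sum_ite_eq']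
  simp

/-- The D/N box Laplacian is invertible and **its inverse is the image-sum kernel**. -/
theorem boxLap_inv_eq (hD : Dset.Nonempty) : (boxLap M Dset)⁻¹ = boxGreenMat M Dset :=
  Matrix.inv_eq_right_inv (boxLap_mul_boxGreenMat hD)

/-- The D/N box Laplacian is invertible (nonempty Dirichlet set). -/
theorem isUnit_det_boxLap (hD : Dset.Nonempty) : IsUnit (boxLap M Dset).det :=
  (Matrix.isUnit_iff_isUnit_det _).1 (IsUnit.of_mul_eq_one _ (boxLap_mul_boxGreenMat hD))

end Summit.QuantumFields.YangMills.Theorems.AllWindowsColdBox.BoxKernel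

end
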